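import Summits.CriticalPhenomena.SAWScalingLimit.Theses.SAWExcursionCardy
import Summits.CriticalPhenomena.SAWScalingLimit.Theorems.SAWRenewalTightnessEventualTightSplit
import Summits.CriticalPhenomena.SAWScalingLimit.Theorems.SAWRenewalTightnessEventualTightVirginization
import Summits.CriticalPhenomena.SAWScalingLimit.Theorems.SAWRenewalTightnessEventualTightAspectReduction
import HarnessLib

/-!
# `EventualTightOfSubs` (stmt-CriticalPhenomena-17941): glue of the split `SAWExcursionCardy.EventualTight ⇐ {ConfinementPositivity, VirginArcTraversalTight}`

Route `SAWExcursionCardy` rev 11 (crux-strategist split of the along-the-mesh tightness crux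
stmt-CriticalPhenomena-1881, 2026-08-17).  The glue item is literally
`ConfinementPositivity → VirginArcTraversalTight → EventualTight`; everything below is a composition
of LANDED theorems of this directory plus the Literature bridge from set-level tightness to tightness
along the mesh filter:

* `bulkShellTightAtAspectTwo_of_virginArcTraversalTight` (`…EventualTightVirginization.lean`, line
  `Sketch` v7 of stmt-1372): the virgin-arc traversal atom X2c₁ gives per-shell traversal-count
  tightness on interior shells of aspect two (two-sided domain-Markov virginization);
* `stub_aspectReduction` (`…EventualTightAspectReduction.lean`): aspect two gives every interior shell,
  i.e. `BulkShellTight` (stmt-17588);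
* `Theorems.EventualTight_of_subs` (`…EventualTightSplit.lean`, p142166): restriction positivity
  (stmt-17587) and `BulkShellTight` give the set-form twin `SAWRenewalTightness.EventualTight` (stmt-1372)
  through the Aizenman–Burchard criterion and the socketed-enlargement split;
* `isTightAlongMesh_of_isTightMeasureSet_image` (`SLEConvergenceCriterion.lean`): set-level tightness on
  `(0, δ₀]` gives `IsTightAlongMesh` (the SAW observable is measurable at every mesh).
-/

namespace Summit.CriticalPhenomena.SAWScalingLimit.Theorems

open Filter
open Literature.Probability.RandomPlanarGeometry Literature.Probability.LatticeModels
open Summit.CriticalPhenomena.SAWScalingLimit.Theses.SAWExcursionCardy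

/-- **Glue item `EventualTightOfSubs` (stmt-CriticalPhenomena-17941) of route `SAWExcursionCardy`:**
`ConfinementPositivity → VirginArcTraversalTight → EventualTight`.  Restriction positivity for nested
Dobrushin domains with common marked-point sockets, plus the exterior-uniform virgin-arc traversal
atom of the critical `ℤ²` SAW at one annulus shape, imply eventual tightness along the mesh of the
critical SAW laws: virginization + aspect reduction give bulk shell tightness, the twin split glue
gives set-level tightness on an initial mesh interval, and the bridge gives tightness along `𝓝[>] 0`.
[cite: AizenmanBurchardDuke1999, Thms 1.1-1.2 and Lemma 3.1; KemppainenSmirnov2017, Thm 1.5 and §4] -/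
theorem eventualTightOfSubs_proof :
    Summit.CriticalPhenomena.SAWScalingLimit.Theses.SAWExcursionCardy.EventualTightOfSubs := by
  intro hE hX D a b hab
  have hset : Summit.CriticalPhenomena.SAWScalingLimit.Theses.SAWRenewalTightness.EventualTight :=
    Theorems.EventualTight_of_subs hE
      (stub_aspectReduction (bulkShellTightAtAspectTwo_of_virginArcTraversalTight hX))
  obtain ⟨δ₀, hδ₀, hT⟩ := hset D a b hab
  exact isTightAlongMesh_of_isTightMeasureSet_image
    (Eventually.of_forall fun δ => SAW.aemeasurable_curve D.carrier δ (a δ) (b δ)) hδ₀ hT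

/-- The parent by name, from the two children (for whoever closes stmt-1881 once both leaves close):
`SAWExcursionCardy.EventualTight` follows from `ConfinementPositivity` and `VirginArcTraversalTight`. -/
theorem eventualTight_of_confinementPositivity_of_virginArcTraversalTight
    (hE : Summit.CriticalPhenomena.SAWScalingLimit.Theses.SAWExcursionCardy.ConfinementPositivity)
    (hX : Summit.CriticalPhenomena.SAWScalingLimit.Theses.SAWExcursionCardy.VirginArcTraversalTight) :
    Summit.CriticalPhenomena.SAWScalingLimit.Theses.SAWExcursionCardy.EventualTight :=
  eventualTightOfSubs_proof hE hX

end Summit.CriticalPhenomena.SAWScalingLimit.Theorems
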